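import Literature.MathematicalPhysics.QuantumFieldTheory.Balaban1983to89.B8Prop5PsiBounds
import Literature.MathematicalPhysics.QuantumFieldTheory.Balaban1983to89.B7Prop2Explicit

/-!
# `Balaban1983to89.B8Prop5Reality` — T. Bałaban, *Spaces of regular gauge field configurations on a lattice and gauge fixing conditions*,
# Commun. Math. Phys. **99** (1985) 75–102 [Balaban1985RegularSpaces] ("B8"), Sect. D p. 93: «The function 𝔉 is obviously an analytic
# function in λ and we consider configurations λ with values in the complexified algebra» — THE SOLUTION OF (1.100) IS NEVERTHELESS A REAL
# (Hermitian-valued) CONFIGURATION: self-adjointness is preserved by every piece of the nonlinearity of (1.88) and passes through the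
# contraction of `B8Prop5ContractionKLevel` (so that `u′ = e^{iλ′}` is unitary, as the socket `hP5` of the Theorem-4 knit requires)

statement-level skeleton of published theorems with citation tags; proofs where landed; nothing here is a claim about the
Yang–Mills mass gap

PDF held: `paper:balaban1985-cmp99-regular-spaces-gauge-fixing` (journal page = PDF page + 74); pp. 90–94; [3] = [Balaban1985Averaging] (22)–(23)
p. 21 («log of a unitary close to 1 is i·(hermitian)», tree: `B7Prop2Explicit.star_mlog_eq_neg`).

WHY THIS FILE (cell `pub-ymgap`, HUMAN RULING D-0062, REBALANCE №41-b; seat `pub-ymgap-dag-n19-b` g2).  The declared OPEN point (iii) of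
`B8Prop5ContractionKLevel`: the fixed point of (1.100) is produced in the COMPLEX Banach space (1.102) (the Lipschitz moduli of
`B8Prop5LocalLipschitz` come from complex analyticity, as in print), while `pub-ymgap-dag-n04-b`'s consumer `B8Thm4ExistsModHFP.hFP_of_lamSubK`
needs the gauge parameter Hermitian (`hsa`).  Print's remark is discharged by INVARIANCE: in a C⋆-algebra every constituent of the
nonlinearity maps Hermitian data to Hermitian values, the Picard iterates of the Neumann inversion stay Hermitian on the `Ω_j`, and Banach's
iteration stays in the closed real subspace (`B8SectDSource.fixedPoint_mem_of_invariant`, here re-run with the invariance asked only ON THE BALL).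

WHAT THIS FILE PROVES (kernel, 0 sorry, theorems only; `𝔸` a nontrivial C⋆-algebra).
* §1 LOCAL REALITY: `isSelfAdjoint_conjExp` (`e^{−ia}Ye^{ia}`), `isSelfAdjoint_conjR_of_unitary`, `isSelfAdjoint_Iinv_smul_mlog`
  (`(1/i) log w` for a unitary `w` near `1`, [3] (22)–(23) BY NAME), `isSelfAdjoint_ad_pow` / **`isSelfAdjoint_gSer_ad`** / **`isSelfAdjoint_gAd`**
  (`g(i ad_Y)X` Hermitian for Hermitian `X`, `Y`: real series in the Hermitian `i[Y, ·]`), `exp_I_smul_mem_unitary`, **`isSelfAdjoint_W182`**,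
  **`isSelfAdjoint_F183`**, **`isSelfAdjoint_F185`**, **`isSelfAdjoint_frakF1/2/3`**, `isSelfAdjoint_covDerivFwd/covDeriv` (unitary background).
* §2 `isSelfAdjoint_Vop`, `isSelfAdjoint_Wsrc`, `isSelfAdjoint_zseq`, **`isSelfAdjoint_zsol`** (on the `Ω_j`: the limit of Hermitian iterates),
  `isSelfAdjoint_PsiP5` (given the letter law `hRreal` read on the `Ω_j`).
* §3 `fixedPoint_kLevel_selfAdjoint_of_ball` (FILE 1's reality transfer with the invariance hypothesis restricted to the ¼α₄-ball) and
  **`propFive_fixedPoint_kLevel_selfAdjoint`**: under the displayed reality of the letters (`R`, `G′` Hermitian-preserving read on the `Ω_j`,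
  `gpar`/`Eterm` Hermitian-preserving on the ball, `D*A`, `A` Hermitian, `U₀` unitary) the fixed point of
  `B8Prop5ContractionKLevel.propFive_fixedPoint_kLevel` is Hermitian at every site.

HONEST SCOPE.  Invariance bookkeeping only; the letters' reality is hypothesised (for [4]'s real operators it is immediate at the pin); nothing
of Proposition 5 beyond `B8Prop5ContractionKLevel` is claimed.  Count-neutral; N05 NOT discharged; nothing continuum / ℝ⁴ / OS / mass-gap / Clay.
Unit `pub-ymgap-dag-n19-b` (g2), 2026-08-26.  Tree API by name only, nothing restated.
-/

noncomputable section

open NormedSpace Metric Set Filter Topology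
open Complex (I I_ne_zero)

namespace Literature.MathematicalPhysics.QuantumFieldTheory.Balaban1983to89.B8Prop5Reality

open Literature.Analysis.Calculus.ExpDifferential (ad ad_apply gSer gSer_apply_eq_tsum ad_pow_succ_apply)
open MatrixLog (mlog)
open B7Prop1Explicit (e expUnit val_expUnit)
open B7Prop2Explicit (star_mlog_eq_neg unitaryUnits mem_unitaryUnits)
open B7Eq78Linearization (conjR conjR_apply)
open B7Eq38Remainder (norm_exp_mul_exp_sub_one_le norm_I_smul')
open B8Ineq132 (covDerivFwd covDeriv)
open B8Eq182Proof (W182 gAd F183 F185 frakF1 frakF2 eq182_alg norm_W182_le)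
open B8Eq184Proof (gaugeExp)
open B8Eq188Proof (frakF3)
open B8LambdaSpaceKLevel (wt lamSubK lamOf saSet mem_saSet zero_mem_saSet isClosed_saSet fpMapK lamOf_fpMapK norm_fpMapK_le
  ext_of_lamOf norm_sub_le_iff)
open B8Prop5LocalLipschitz (gAd_eq_gSer_ad conjR_expUnit_inv_eq conjR_expUnit_neg_eq rexp_one_sixth_le norm_conjExp_le)
open B8Prop5ContractionKLevel (Bd2 Zseq Zsol zseq_zero zseq_succ tendsto_zsol Vop Wsrc Vop_sub norm_Vop_le wt_sq_norm_Wsrc_le PsiP5 Mc Kc mWc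
  KWc mWc_nonneg propFive_fixedPoint_kLevel bd2_zsol eta_mul_le_of_wt_mul_le)
open B8Prop5PsiBounds (psiP5_bd2 psiP5_sub_bd2)
open B8SectDSource (fixedPoint_mem_of_invariant)

-- `Site` alone could resolve to the torus sites of `Setup.lean`; re-export the `ℤ^d` sites of `B7Prop1Explicit`.
export B7Prop1Explicit (Site)

variable {d : ℕ} {𝔸 : Type*} [CStarAlgebra 𝔸] [Nontrivial 𝔸]

/-! ## §1 Local reality: every constituent of the nonlinearity of (1.88) maps Hermitian data to Hermitian values -/

section Local

omit [Nontrivial 𝔸] in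
/-- `star (I • a) = −(I • a)` for Hermitian `a`: `ia` is skew-adjoint. [cite: Balaban1985Averaging, (22)–(23) p.21] -/
theorem star_I_smul {a : 𝔸} (ha : IsSelfAdjoint a) : star (I • a : 𝔸) = -(I • a) := by
  rw [star_smul, ha.star_eq, Complex.star_def, Complex.conj_I, neg_smul]

omit [Nontrivial 𝔸] in
/-- `I • a ∈ skewAdjoint 𝔸` for Hermitian `a`. [cite: Balaban1985Averaging, (22)–(23) p.21] -/
theorem I_smul_mem_skewAdjoint {a : 𝔸} (ha : IsSelfAdjoint a) : (I • a : 𝔸) ∈ skewAdjoint 𝔸 :=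
  skewAdjoint.mem_iff.mpr (star_I_smul ha)

omit [Nontrivial 𝔸] in
/-- **`e^{ia}` is unitary for Hermitian `a`** (Mathlib: the exponential of a skew-adjoint element is unitary).
[cite: Balaban1985Averaging, (22)–(23) p.21] -/
theorem exp_I_smul_mem_unitary {a : 𝔸} (ha : IsSelfAdjoint a) : exp (I • a : 𝔸) ∈ unitary 𝔸 := by
  letI : NormedAlgebra ℚ 𝔸 := NormedAlgebra.restrictScalars ℚ ℂ 𝔸
  exact NormedSpace.exp_mem_unitary_of_mem_skewAdjoint (I_smul_mem_skewAdjoint ha)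

omit [Nontrivial 𝔸] in
/-- **The conjugation of (1.88) preserves Hermitian elements**: `e^{−ia}Ye^{ia}` is Hermitian for Hermitian `a`, `Y`.
[cite: Balaban1985RegularSpaces, (1.88) p.91] -/
theorem isSelfAdjoint_conjExp {a Y : 𝔸} (ha : IsSelfAdjoint a) (hY : IsSelfAdjoint Y) :
    IsSelfAdjoint (exp (-(I • a)) * Y * exp (I • a)) := by
  rw [IsSelfAdjoint, star_mul, star_mul, star_exp, star_exp, star_neg, star_I_smul ha, neg_neg, hY.star_eq, ← mul_assoc]

omit [Nontrivial 𝔸] in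
/-- Conjugation by a UNITARY preserves Hermitian elements: `R(u)Y = uYu⁻¹ = uYu⋆`. [cite: Balaban1985RegularSpaces, (1.1) p.76] -/
theorem isSelfAdjoint_conjR_of_unitary {u : 𝔸ˣ} (hu : u ∈ unitaryUnits 𝔸) {Y : 𝔸} (hY : IsSelfAdjoint Y) : IsSelfAdjoint (conjR u Y) := by
  have hu' := mem_unitaryUnits.1 hu
  have hinv : ((u⁻¹ : 𝔸ˣ) : 𝔸) = star (u : 𝔸) := by
    have h1 : (u : 𝔸) * star (u : 𝔸) = 1 := Unitary.mul_star_self_of_mem hu'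
    calc ((u⁻¹ : 𝔸ˣ) : 𝔸) = ((u⁻¹ : 𝔸ˣ) : 𝔸) * ((u : 𝔸) * star (u : 𝔸)) := by rw [h1, mul_one]
      _ = star (u : 𝔸) := by rw [← mul_assoc, Units.inv_mul, one_mul]
  rw [IsSelfAdjoint, conjR_apply, hinv, star_mul, star_mul, star_star, hY.star_eq, mul_assoc]

omit [Nontrivial 𝔸] in
/-- **`(1/i) log w` is Hermitian for a unitary `w` with `‖w − 1‖ ≤ 1/4`** ([3] (22)–(23): `log w` is skew-adjoint, `B7Prop2Explicit.star_mlog_eq_neg`).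
[cite: Balaban1985Averaging, (22)–(23) p.21] -/
theorem isSelfAdjoint_Iinv_smul_mlog {w : 𝔸} (hw : w ∈ unitary 𝔸) (h : ‖w - 1‖ ≤ 1 / 4) : IsSelfAdjoint ((I⁻¹ : ℂ) • mlog w) := by
  rw [IsSelfAdjoint, star_smul, star_mlog_eq_neg hw h, Complex.inv_I, Complex.star_def, map_neg, Complex.conj_I, neg_neg, smul_neg,
    neg_smul]

omit [Nontrivial 𝔸] in
/-- `(ad_{ia})ⁿ X` is Hermitian for Hermitian `a`, `X` (`ad_{ia}X = i[a, X]` is Hermitian). [cite: Balaban1985Averaging, (29) p.22] -/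
theorem isSelfAdjoint_ad_pow {a X : 𝔸} (ha : IsSelfAdjoint a) (hX : IsSelfAdjoint X) (n : ℕ) :
    IsSelfAdjoint ((ad ℂ (I • a) ^ n) X) := by
  induction n with
  | zero => simpa using hX
  | succ n ih =>
    rw [ad_pow_succ_apply]
    set Z := (ad ℂ (I • a) ^ n) X with hZ
    rw [IsSelfAdjoint, star_sub, star_mul, star_mul, star_I_smul ha, ih.star_eq]
    simp only [neg_mul, mul_neg, sub_neg_eq_add, neg_add_eq_sub]

omit [Nontrivial 𝔸] in
/-- **`g(ad_{ia})X` is Hermitian for Hermitian `a`, `X`**: the operator series (33) has real coefficients and acts through the Hermitian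
`(ad_{ia})ⁿX`. [cite: Balaban1985Averaging, (33) p.22] -/
theorem isSelfAdjoint_gSer_ad {a X : 𝔸} (ha : IsSelfAdjoint a) (hX : IsSelfAdjoint X) : IsSelfAdjoint (gSer ℂ (ad ℂ (I • a)) X) := by
  rw [gSer_apply_eq_tsum, IsSelfAdjoint, tsum_star]
  refine tsum_congr fun n => ?_
  rw [star_smul, (isSelfAdjoint_ad_pow ha hX n).star_eq]
  congr 1
  simp

omit [Nontrivial 𝔸] in
/-- **`g(i ad_Y)X` (p05's `gAd X Y`) is Hermitian** for Hermitian `X`, `Y` with `‖Y‖ ≤ 1/12` (`B8Prop5LocalLipschitz.gAd_eq_gSer_ad`).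
[cite: Balaban1985RegularSpaces, (1.82), (1.84) p.90] -/
theorem isSelfAdjoint_gAd {X Y : 𝔸} (hX : IsSelfAdjoint X) (hY : IsSelfAdjoint Y) (hYn : ‖Y‖ ≤ 1 / 12) : IsSelfAdjoint (gAd X Y) := by
  rw [gAd_eq_gSer_ad X hYn]; exact isSelfAdjoint_gSer_ad hY hX

omit [Nontrivial 𝔸] in
/-- The argument of the logarithm in (1.82), `e^{−iY}e^{iY+iX}`, is unitary for Hermitian `X`, `Y`. [cite: Balaban1985RegularSpaces, (1.82) p.90] -/
theorem arg182_mem_unitary {X Y : 𝔸} (hX : IsSelfAdjoint X) (hY : IsSelfAdjoint Y) :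
    exp (-(I • Y)) * exp (I • Y + I • X) ∈ unitary 𝔸 := by
  have h1 : exp (-(I • Y) : 𝔸) ∈ unitary 𝔸 := by
    rw [← smul_neg]; exact exp_I_smul_mem_unitary hY.neg
  have h2 : exp (I • Y + I • X : 𝔸) ∈ unitary 𝔸 := by
    rw [← smul_add]; exact exp_I_smul_mem_unitary (hY.add hX)
  exact Submonoid.mul_mem _ h1 h2

omit [Nontrivial 𝔸] in
/-- Radius bookkeeping: `‖e^{−iY}e^{iY+iX} − 1‖ ≤ 1/4` for `‖X‖ ≤ 1/12`, `‖Y‖ ≤ 1/24`. [cite: Balaban1985RegularSpaces, (1.82) p.90] -/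
theorem norm_arg182_sub_one_le_quarter {X Y : 𝔸} (hX : ‖X‖ ≤ 1 / 12) (hY : ‖Y‖ ≤ 1 / 24) :
    ‖exp (-(I • Y)) * exp (I • Y + I • X) - 1‖ ≤ 1 / 4 := by
  have h1 := norm_exp_mul_exp_sub_one_le (-(I • Y)) (I • Y + I • X)
  have h2 : ‖(-(I • Y) : 𝔸)‖ + ‖I • Y + I • X‖ ≤ 2 * ‖Y‖ + ‖X‖ := by
    rw [norm_neg, norm_I_smul']
    have := norm_add_le (I • Y : 𝔸) (I • X)
    rw [norm_I_smul', norm_I_smul'] at this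
    linarith
  have hs : 2 * ‖Y‖ + ‖X‖ ≤ 1 / 6 := by linarith
  have h3 : Real.exp (2 * ‖Y‖ + ‖X‖) ≤ 1 + (2 * ‖Y‖ + ‖X‖) + (2 * ‖Y‖ + ‖X‖) ^ 2 := by
    have := (abs_le.mp (Real.abs_exp_sub_one_sub_id_le (x := 2 * ‖Y‖ + ‖X‖)
      (abs_le.mpr ⟨by nlinarith [norm_nonneg X, norm_nonneg Y], by linarith⟩))).2
    linarith
  have h4 : (2 * ‖Y‖ + ‖X‖) + (2 * ‖Y‖ + ‖X‖) ^ 2 ≤ 1 / 4 := by nlinarith [norm_nonneg X, norm_nonneg Y]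
  calc ‖exp (-(I • Y)) * exp (I • Y + I • X) - 1‖ ≤ Real.exp (‖(-(I • Y) : 𝔸)‖ + ‖I • Y + I • X‖) - 1 := h1
    _ ≤ Real.exp (2 * ‖Y‖ + ‖X‖) - 1 := by gcongr
    _ ≤ 1 / 4 := by linarith

omit [Nontrivial 𝔸] in
/-- **The exponent (1.82) `W182 X Y = (1/i) log(e^{−iY}e^{iY+iX})` is Hermitian** for Hermitian `X`, `Y` with `‖X‖ ≤ 1/12`, `‖Y‖ ≤ 1/24`.
[cite: Balaban1985RegularSpaces, (1.82) p.90] -/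
theorem isSelfAdjoint_W182 {X Y : 𝔸} (hX : IsSelfAdjoint X) (hY : IsSelfAdjoint Y) (hXn : ‖X‖ ≤ 1 / 12) (hYn : ‖Y‖ ≤ 1 / 24) :
    IsSelfAdjoint (W182 X Y) :=
  isSelfAdjoint_Iinv_smul_mlog (arg182_mem_unitary hX hY) (norm_arg182_sub_one_le_quarter hXn hYn)

omit [Nontrivial 𝔸] in
/-- **The remainder `F183 X Y = O(|X|²)` of (1.82)–(1.83) is Hermitian** for Hermitian small `X`, `Y` (`F183 = W182 − g(i ad)`, `eq182_alg`).
[cite: Balaban1985RegularSpaces, (1.82)–(1.83) p.90] -/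
theorem isSelfAdjoint_F183 {X Y : 𝔸} (hX : IsSelfAdjoint X) (hY : IsSelfAdjoint Y) (hXn : ‖X‖ ≤ 1 / 12) (hYn : ‖Y‖ ≤ 1 / 24) :
    IsSelfAdjoint (F183 X Y) := by
  have hY12 : ‖Y‖ ≤ 1 / 12 := by linarith
  have h := eq182_alg (X := X) (by linarith) hY12
  have hF : F183 X Y = W182 X Y - gAd X Y := by rw [h]; abel
  rw [hF]
  exact (isSelfAdjoint_W182 hX hY hXn hYn).sub (isSelfAdjoint_gAd hX hY hY12)

/-- **The BCH defect `F185 a X Y` of (1.84)–(1.85) is Hermitian** for Hermitian `a`, `X`, `Y` with `‖a‖ ≤ 1/10`, `‖X‖ ≤ 1/70`, `‖Y‖ ≤ 1/24`.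
[cite: Balaban1985RegularSpaces, (1.84)–(1.85) p.90] -/
theorem isSelfAdjoint_F185 {a X Y : 𝔸} (ha : IsSelfAdjoint a) (hX : IsSelfAdjoint X) (hY : IsSelfAdjoint Y) (han : ‖a‖ ≤ 1 / 10)
    (hXn : ‖X‖ ≤ 1 / 70) (hYn : ‖Y‖ ≤ 1 / 24) : IsSelfAdjoint (F185 a X Y) := by
  have hW : IsSelfAdjoint (W182 X Y) := isSelfAdjoint_W182 hX hY (by linarith) hYn
  have hWn : ‖W182 X Y‖ ≤ 7 * ‖X‖ := norm_W182_le (by linarith) (by linarith)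
  -- the argument of the outer logarithm is unitary and within 1/4 of 1
  have hu : exp (I • a) * exp (I • W182 X Y) ∈ unitary 𝔸 :=
    Submonoid.mul_mem _ (exp_I_smul_mem_unitary ha) (exp_I_smul_mem_unitary hW)
  have hq : ‖exp (I • a) * exp (I • W182 X Y) - 1‖ ≤ 1 / 4 := by
    have h1 := norm_exp_mul_exp_sub_one_le (I • a) (I • W182 X Y)
    rw [norm_I_smul', norm_I_smul'] at h1
    have hs : ‖a‖ + ‖W182 X Y‖ ≤ 1 / 5 := by nlinarith [norm_nonneg X]
    have h3 : Real.exp (‖a‖ + ‖W182 X Y‖) ≤ 1 + (‖a‖ + ‖W182 X Y‖) + (‖a‖ + ‖W182 X Y‖) ^ 2 := by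
      have := (abs_le.mp (Real.abs_exp_sub_one_sub_id_le (x := ‖a‖ + ‖W182 X Y‖)
        (abs_le.mpr ⟨by nlinarith [norm_nonneg a, norm_nonneg (W182 X Y)], by linarith⟩))).2
      linarith
    have h4 : (‖a‖ + ‖W182 X Y‖) + (‖a‖ + ‖W182 X Y‖) ^ 2 ≤ 1 / 4 := by nlinarith [norm_nonneg a, norm_nonneg (W182 X Y)]
    linarith
  have hlog := isSelfAdjoint_Iinv_smul_mlog hu hq
  have hF : F185 a X Y = (I⁻¹ : ℂ) • mlog (exp (I • a) * exp (I • W182 X Y)) - a - W182 X Y := by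
    rw [F185, smul_sub, smul_sub, smul_smul, smul_smul, inv_mul_cancel₀ I_ne_zero, one_smul, one_smul]
  rw [hF]
  exact (hlog.sub ha).sub hW

omit [Nontrivial 𝔸] in
/-- Real scalars preserve Hermitian elements (`star (r • x) = r • star x`). [cite: Balaban1985RegularSpaces, (1.83) p.90] -/
theorem isSelfAdjoint_real_smul (r : ℝ) {x : 𝔸} (hx : IsSelfAdjoint x) : IsSelfAdjoint (r • x) := by
  rw [IsSelfAdjoint, star_smul, hx.star_eq, star_trivial]

omit [Nontrivial 𝔸] in
/-- **`𝔉₁(l, D)` of (1.82)–(1.83) is Hermitian** for Hermitian `l`, `D` in the window `‖l‖ ≤ 1/24`, `η‖D‖ ≤ 1/12` (`η > 0`).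
[cite: Balaban1985RegularSpaces, (1.83) p.90] -/
theorem isSelfAdjoint_frakF1 {η : ℝ} (hη : 0 < η) {l D : 𝔸} (hl : IsSelfAdjoint l) (hD : IsSelfAdjoint D) (hln : ‖l‖ ≤ 1 / 24)
    (hDn : η * ‖D‖ ≤ 1 / 12) : IsSelfAdjoint (frakF1 η l D) := by
  have hX : IsSelfAdjoint (η • D) := isSelfAdjoint_real_smul η hD
  have hXn : ‖(η • D : 𝔸)‖ ≤ 1 / 12 := by rwa [norm_smul, Real.norm_of_nonneg hη.le]
  rw [frakF1]
  exact isSelfAdjoint_real_smul _ (isSelfAdjoint_F183 hX hl hXn hln)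

/-- **`𝔉₂(l, D, A_b)` of (1.84)–(1.85) is Hermitian** for Hermitian `l`, `D`, `A_b` in the window `‖l‖ ≤ 1/24`, `η‖D‖ ≤ 1/70`, `η‖A_b‖ ≤ 1/13`.
[cite: Balaban1985RegularSpaces, (1.85) p.90] -/
theorem isSelfAdjoint_frakF2 {η : ℝ} (hη : 0 < η) {l D Ab : 𝔸} (hl : IsSelfAdjoint l) (hD : IsSelfAdjoint D) (hA : IsSelfAdjoint Ab)
    (hln : ‖l‖ ≤ 1 / 24) (hDn : η * ‖D‖ ≤ 1 / 70) (hAn : η * ‖Ab‖ ≤ 1 / 13) : IsSelfAdjoint (frakF2 η l D Ab) := by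
  have hX : IsSelfAdjoint (η • D) := isSelfAdjoint_real_smul η hD
  have hXn : ‖(η • D : 𝔸)‖ ≤ 1 / 70 := by rwa [norm_smul, Real.norm_of_nonneg hη.le]
  have hconj : IsSelfAdjoint (conjR (expUnit (-(I • l))) Ab) := by
    rw [conjR_expUnit_neg_eq]; exact isSelfAdjoint_conjExp hl hA
  have ha : IsSelfAdjoint (η • conjR (expUnit (-(I • l))) Ab) := isSelfAdjoint_real_smul η hconj
  have han : ‖(η • conjR (expUnit (-(I • l))) Ab : 𝔸)‖ ≤ 1 / 10 := by
    have h := B8Prop5LocalLipschitz.norm_eta_conj_le hη.le (by linarith : ‖l‖ ≤ 1 / 12) Ab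
    linarith
  rw [frakF2]
  exact isSelfAdjoint_real_smul _ (isSelfAdjoint_F185 ha hX hl han hXn hln)

omit [Nontrivial 𝔸] in
/-- The forward covariant difference (1.1) at a UNITARY background preserves Hermitian configurations.
[cite: Balaban1985RegularSpaces, (1.1) p.76] -/
theorem isSelfAdjoint_covDerivFwd {η : ℝ} {U₀ : Site d → Fin d → 𝔸ˣ} (hU₀ : ∀ x κ, U₀ x κ ∈ unitaryUnits 𝔸) {f : Site d → 𝔸}
    (hf : ∀ x, IsSelfAdjoint (f x)) (μ : Fin d) (x : Site d) : IsSelfAdjoint (covDerivFwd η U₀ μ f x) := by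
  rw [covDerivFwd]
  exact isSelfAdjoint_real_smul _ ((isSelfAdjoint_conjR_of_unitary (hU₀ x μ) (hf _)).sub (hf x))

omit [Nontrivial 𝔸] in
/-- The backward covariant difference (1.1) at a UNITARY background preserves Hermitian configurations.
[cite: Balaban1985RegularSpaces, (1.1) p.76] -/
theorem isSelfAdjoint_covDeriv {η : ℝ} {U₀ : Site d → Fin d → 𝔸ˣ} (hU₀ : ∀ x κ, U₀ x κ ∈ unitaryUnits 𝔸) {f : Site d → 𝔸}
    (hf : ∀ x, IsSelfAdjoint (f x)) (μ : Fin d) (x : Site d) : IsSelfAdjoint (covDeriv η U₀ μ f x) := by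
  rw [covDeriv]
  exact isSelfAdjoint_real_smul _ ((isSelfAdjoint_conjR_of_unitary ((unitaryUnits 𝔸).inv_mem (hU₀ _ μ)) (hf _)).sub (hf x))

/-- **`𝔉₃,μ(a, A)(x)` of (1.88)–(1.89) is Hermitian** for Hermitian `a`, `A`, unitary `U₀`, in the window `‖a(x)‖ ≤ 1/24`, `η‖D_μa(x)‖, η‖D*_μa(x)‖ ≤ 1/70`,
`η‖A_μ(x)‖, η‖R(U₀)A_μ(x − e_μ)‖ ≤ 1/13`. [cite: Balaban1985RegularSpaces, (1.88)–(1.89) p.91] -/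
theorem isSelfAdjoint_frakF3 {η : ℝ} (hη : 0 < η) {U₀ : Site d → Fin d → 𝔸ˣ} (hU₀ : ∀ x κ, U₀ x κ ∈ unitaryUnits 𝔸) {a : Site d → 𝔸}
    {A : Site d → Fin d → 𝔸} (ha : ∀ x, IsSelfAdjoint (a x)) (hA : ∀ x μ, IsSelfAdjoint (A x μ)) {x : Site d} {μ : Fin d}
    (han : ‖a x‖ ≤ 1 / 24) (hD : η * ‖covDerivFwd η U₀ μ a x‖ ≤ 1 / 70) (hDs : η * ‖covDeriv η U₀ μ a x‖ ≤ 1 / 70)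
    (hAn : η * ‖A x μ‖ ≤ 1 / 13) (hYn : η * ‖conjR (U₀ (x - e μ) μ)⁻¹ (A (x - e μ) μ)‖ ≤ 1 / 13) :
    IsSelfAdjoint (frakF3 η U₀ a A x μ) := by
  have hDsa := isSelfAdjoint_covDerivFwd (η := η) hU₀ ha μ x
  have hDssa := isSelfAdjoint_covDeriv (η := η) hU₀ ha μ x
  have hYsa : IsSelfAdjoint (conjR (U₀ (x - e μ) μ)⁻¹ (A (x - e μ) μ)) :=
    isSelfAdjoint_conjR_of_unitary ((unitaryUnits 𝔸).inv_mem (hU₀ _ μ)) (hA _ μ)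
  rw [frakF3]
  refine IsSelfAdjoint.neg ?_
  refine ((IsSelfAdjoint.add ?_ ?_).add ?_).add ?_
  · exact isSelfAdjoint_frakF1 hη (ha x) hDssa han (by linarith)
  · exact isSelfAdjoint_frakF1 hη (ha x) hDsa han (by linarith)
  · exact isSelfAdjoint_frakF2 hη (ha x) hDssa hYsa.neg han hDs (by rwa [norm_neg])
  · exact isSelfAdjoint_frakF2 hη (ha x) hDsa (hA x μ) han hD hAn

end Local

/-! ## §2 `V`, `W`, the Neumann solution `Z` and `Ψ` preserve Hermitian data on the `Ω_j` -/

section Global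

variable {L k : ℕ} {η : ℝ} {Ω : ℕ → Set (Site d)} {U₀ : Site d → Fin d → 𝔸ˣ} {A : Site d → Fin d → 𝔸} {DA : Site d → 𝔸}

omit [Nontrivial 𝔸] in
/-- `(V_a f)(x) = g(i ad_{a(x)})f(x) − f(x)` is Hermitian when `a(x)`, `f(x)` are (`‖a(x)‖ ≤ 1/12`). [cite: Balaban1985RegularSpaces, (1.94) p.92] -/
theorem isSelfAdjoint_Vop {a f : Site d → 𝔸} {x : Site d} (ha : IsSelfAdjoint (a x)) (han : ‖a x‖ ≤ 1 / 12) (hf : IsSelfAdjoint (f x)) :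
    IsSelfAdjoint (Vop a f x) := by
  rw [Vop]; exact (isSelfAdjoint_gAd hf ha han).sub hf

/-- **`W` is Hermitian on the `Ω_j`** for Hermitian `a`, `E`, `D*A`, `A` and unitary `U₀`, in the windows of `wt_sq_norm_Wsrc_le` (`‖a‖ ≤ 1/24`,
`(Lʲη)‖Da‖ ≤ b₁ ≤ 1/140`, `(Lʲη)‖A‖ ≤ c_A ≤ 1/13`). [cite: Balaban1985RegularSpaces, (1.88) p.91, (1.93)–(1.95) p.92] -/
theorem isSelfAdjoint_Wsrc (hL : 1 ≤ L) (hη : 0 < η) (hU₀ : ∀ x κ, U₀ x κ ∈ unitaryUnits 𝔸) {a E : Site d → 𝔸} {j : ℕ} {x : Site d}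
    {b₁ cA : ℝ} (hb : b₁ ≤ 1 / 140) (hc : cA ≤ 1 / 13)
    (ha : ∀ y, IsSelfAdjoint (a y)) (hE : IsSelfAdjoint (E x)) (hDA : IsSelfAdjoint (DA x)) (hA : ∀ y μ, IsSelfAdjoint (A y μ))
    (han : ‖a x‖ ≤ 1 / 24)
    (hD : ∀ μ, wt L η j * ‖covDerivFwd η U₀ μ a x‖ ≤ b₁ ∧ wt L η j * ‖covDeriv η U₀ μ a x‖ ≤ b₁)
    (hAw : ∀ μ, wt L η j * ‖A x μ‖ ≤ cA ∧ wt L η j * ‖conjR (U₀ (x - e μ) μ)⁻¹ (A (x - e μ) μ)‖ ≤ cA) :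
    IsSelfAdjoint (Wsrc η U₀ A DA a E x) := by
  rw [Wsrc]
  refine (IsSelfAdjoint.add ?_ ?_).add ?_
  · rw [gaugeExp, conjR_expUnit_inv_eq]; exact isSelfAdjoint_conjExp (ha x) hDA
  · exact isSelfAdjoint_gAd hE (ha x) (by linarith)
  · refine isSelfAdjoint_sum (Finset.univ) fun μ _ => ?_
    exact isSelfAdjoint_frakF3 hη hU₀ ha hA han
      ((eta_mul_le_of_wt_mul_le hL hη j (norm_nonneg _) (hD μ).1).trans (by linarith))
      ((eta_mul_le_of_wt_mul_le hL hη j (norm_nonneg _) (hD μ).2).trans (by linarith))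
      ((eta_mul_le_of_wt_mul_le hL hη j (norm_nonneg _) (hAw μ).1).trans hc)
      ((eta_mul_le_of_wt_mul_le hL hη j (norm_nonneg _) (hAw μ).2).trans hc)

variable {W : Site d → 𝔸} {V R : (Site d → 𝔸) → (Site d → 𝔸)}

omit [Nontrivial 𝔸] in
/-- **The Picard iterates of the Neumann inversion stay Hermitian on the `Ω_j`** when `W` is Hermitian there, `V` preserves Hermitian values at
Ω-sites and the letter `R` maps Hermitian-on-Ω data to Hermitian-on-Ω values (`hRreal`). [cite: Balaban1985RegularSpaces, (1.96) p.92] -/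
theorem isSelfAdjoint_zseq
    (hW : ∀ j, j ≤ k → ∀ x ∈ Ω j, IsSelfAdjoint (W x))
    (hV : ∀ f : Site d → 𝔸, ∀ j, j ≤ k → ∀ x ∈ Ω j, IsSelfAdjoint (f x) → IsSelfAdjoint (V f x))
    (hRreal : ∀ f : Site d → 𝔸, (∀ j, j ≤ k → ∀ x ∈ Ω j, IsSelfAdjoint (f x)) → ∀ j, j ≤ k → ∀ x ∈ Ω j, IsSelfAdjoint (R f x)) :
    ∀ n, ∀ j, j ≤ k → ∀ x ∈ Ω j, IsSelfAdjoint (Zseq W V R n x) := by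
  intro n
  induction n with
  | zero => intro j hj x hx; rw [zseq_zero]; exact hW j hj x hx
  | succ n ih =>
    intro j hj x hx
    rw [zseq_succ]
    exact (hW j hj x hx).sub (hV _ j hj x hx (hRreal _ ih j hj x hx))

omit [Nontrivial 𝔸] in
/-- **`Z = (I + VR)⁻¹W` is Hermitian on the `Ω_j`**: there it is the limit of the Hermitian iterates (`tendsto_zsol`) and the Hermitian elements
form a closed set. [cite: Balaban1985RegularSpaces, (1.96) p.92] -/
theorem isSelfAdjoint_zsol (hL : 1 ≤ L) (hη : 0 < η) {cV BR mW : ℝ}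
    (hVsub : ∀ f g : Site d → 𝔸, ∀ j, j ≤ k → ∀ x ∈ Ω j, V f x - V g x = V (f - g) x)
    (hVbd : ∀ f : Site d → 𝔸, ∀ j, j ≤ k → ∀ x ∈ Ω j, ‖V f x‖ ≤ cV * ‖f x‖)
    (hRsub : ∀ f g : Site d → 𝔸, R (f - g) = R f - R g)
    (hRbd : ∀ (f : Site d → 𝔸) (m : ℝ), 0 ≤ m → Bd2 L η k Ω f m → Bd2 L η k Ω (R f) (BR * m))
    (hWb : Bd2 L η k Ω W mW) (hcV : 0 ≤ cV) (hBR : 0 ≤ BR) (hmW : 0 ≤ mW) (hθ : cV * BR ≤ 1 / 2)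
    (hW : ∀ j, j ≤ k → ∀ x ∈ Ω j, IsSelfAdjoint (W x))
    (hV : ∀ f : Site d → 𝔸, ∀ j, j ≤ k → ∀ x ∈ Ω j, IsSelfAdjoint (f x) → IsSelfAdjoint (V f x))
    (hRreal : ∀ f : Site d → 𝔸, (∀ j, j ≤ k → ∀ x ∈ Ω j, IsSelfAdjoint (f x)) → ∀ j, j ≤ k → ∀ x ∈ Ω j, IsSelfAdjoint (R f x))
    {j : ℕ} (hj : j ≤ k) {x : Site d} (hx : x ∈ Ω j) : IsSelfAdjoint (Zsol W V R x) := by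
  have ht := tendsto_zsol hL hη hVsub hVbd hRsub hRbd hWb hcV hBR hmW hθ hj hx
  have hcl : IsClosed {y : 𝔸 | IsSelfAdjoint y} := isClosed_eq continuous_star continuous_id
  exact hcl.mem_of_tendsto ht (Eventually.of_forall fun n => isSelfAdjoint_zseq hW hV hRreal n j hj x hx)

end Global

/-! ## §3 The fixed point of (1.100) is a REAL configuration -/

section FixedPoint

variable {L k : ℕ} {η : ℝ} {Ω : ℕ → Set (Site d)} {Eb : ℕ → Set (Site d × Fin d)} {U₀ : Site d → Fin d → 𝔸ˣ}
  {A : Site d → Fin d → 𝔸} {DA : Site d → 𝔸}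

omit [Nontrivial 𝔸] in
/-- **FILE 1's reality transfer with the invariance asked ONLY ON THE BALL**: if `G′ ∘ Ψ` maps the Hermitian elements of the closed ¼α₄-ball to
Hermitian configurations, the fixed point of `B8LambdaSpaceKLevel.fixedPoint_kLevel` is Hermitian (Banach's iteration from `0` stays in the closed
real subset; `B8SectDSource.fixedPoint_mem_of_invariant`). [cite: Balaban1985RegularSpaces, p.93 (after (1.102)), (1.100) p.93] -/
theorem fixedPoint_kLevel_selfAdjoint_of_ball (hη : 0 ≤ η) (Ω : ℕ → Set (Site d)) (Gp Ψ : (Site d → 𝔸) → (Site d → 𝔸))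
    {α₄ B₀' M K : ℝ} (hα₄ : 0 ≤ α₄) (hB : 0 ≤ B₀') (hM : 0 ≤ M) (hK : 0 ≤ K)
    (hG : ∀ (f : Site d → 𝔸) (m : ℝ), 0 ≤ m → (∀ j, j ≤ k → ∀ x ∈ Ω j, wt L η j ^ 2 * ‖f x‖ ≤ m) →
      (∀ x, ‖Gp f x‖ ≤ B₀' * m) ∧ ∀ j, j ≤ k → ∀ p ∈ Eb j, wt L η j * ‖covDerivFwd η U₀ p.2 (Gp f) p.1‖ ≤ B₀' * m)
    (hGsub : ∀ f g : Site d → 𝔸, Gp (f - g) = Gp f - Gp g)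
    (hΨ0 : ∀ s : lamSubK η U₀ L k Eb, ‖s‖ ≤ α₄ / 4 → ∀ j, j ≤ k → ∀ x ∈ Ω j, wt L η j ^ 2 * ‖Ψ (lamOf s) x‖ ≤ M)
    (hΨ1 : ∀ s t : lamSubK η U₀ L k Eb, ‖s‖ ≤ α₄ / 4 → ‖t‖ ≤ α₄ / 4 →
      ∀ j, j ≤ k → ∀ x ∈ Ω j, wt L η j ^ 2 * ‖Ψ (lamOf s) x - Ψ (lamOf t) x‖ ≤ K * ‖s - t‖)
    (h103 : B₀' * M ≤ α₄ / 4) (h106 : B₀' * K ≤ 1 / 2)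
    (hreal : ∀ s : lamSubK η U₀ L k Eb, ‖s‖ ≤ α₄ / 4 → (∀ x, IsSelfAdjoint (lamOf s x)) → ∀ x, IsSelfAdjoint (Gp (Ψ (lamOf s)) x))
    {s : lamSubK η U₀ L k Eb} (hs : ‖s‖ ≤ α₄ / 4) (hfix : lamOf s = Gp (Ψ (lamOf s))) :
    ∀ x, IsSelfAdjoint (lamOf s x) := by
  set T := fpMapK hη Ω Gp Ψ α₄ B₀' M hG hM hΨ0 with hT
  have hmaps : ∀ s : lamSubK η U₀ L k Eb, ‖s‖ ≤ α₄ / 4 → ‖T s‖ ≤ α₄ / 4 := fun s hs =>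
    (norm_fpMapK_le hη Ω Gp Ψ α₄ B₀' M hG hM hΨ0 hs).trans h103
  have hlip : ∀ s t : lamSubK η U₀ L k Eb, ‖s‖ ≤ α₄ / 4 → ‖t‖ ≤ α₄ / 4 → ‖T s - T t‖ ≤ B₀' * K * ‖s - t‖ := by
    intro s t hs ht
    have hm : 0 ≤ K * ‖s - t‖ := by positivity
    have hdiff : ∀ j, j ≤ k → ∀ x ∈ Ω j, wt L η j ^ 2 * ‖(Ψ (lamOf s) - Ψ (lamOf t)) x‖ ≤ K * ‖s - t‖ := fun j hj x hx => by
      simpa only [Pi.sub_apply] using hΨ1 s t hs ht j hj x hx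
    obtain ⟨h0, h1⟩ := hG (Ψ (lamOf s) - Ψ (lamOf t)) (K * ‖s - t‖) hm hdiff
    rw [show B₀' * K * ‖s - t‖ = B₀' * (K * ‖s - t‖) by ring]
    refine (norm_sub_le_iff hη (T s) (T t) (by positivity)).2 ⟨fun x => ?_, fun j hj p hp => ?_⟩
    · rw [hT, lamOf_fpMapK hη Ω Gp Ψ α₄ B₀' M hG hM hΨ0 hs, lamOf_fpMapK hη Ω Gp Ψ α₄ B₀' M hG hM hΨ0 ht, ← Pi.sub_apply,
        ← hGsub]
      exact h0 x
    · rw [hT, lamOf_fpMapK hη Ω Gp Ψ α₄ B₀' M hG hM hΨ0 hs, lamOf_fpMapK hη Ω Gp Ψ α₄ B₀' M hG hM hΨ0 ht, ← hGsub]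
      exact h1 j hj p hp
  have hκ1 : B₀' * K < 1 := by linarith
  have hinv : ∀ t ∈ saSet η U₀ L k Eb, ‖t‖ ≤ α₄ / 4 → T t ∈ saSet η U₀ L k Eb := by
    intro t ht htn x
    rw [hT, lamOf_fpMapK hη Ω Gp Ψ α₄ B₀' M hG hM hΨ0 htn]
    exact hreal t htn ht x
  have hTfix : T s = s := by
    apply ext_of_lamOf
    rw [hT, lamOf_fpMapK hη Ω Gp Ψ α₄ B₀' M hG hM hΨ0 hs]
    exact hfix.symm
  exact fixedPoint_mem_of_invariant T (by positivity) (by positivity) hκ1 hmaps hlip (saSet η U₀ L k Eb) isClosed_saSet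
    zero_mem_saSet hinv hs hTfix

/-- **THE FIXED POINT OF (1.100) IS HERMITIAN** (print p. 93: the complexification is only a device): in the setting of
`B8Prop5ContractionKLevel.propFive_fixedPoint_kLevel`, assume in addition the DISPLAYED REALITY of the data — `U₀` unitary, `A` and `D*A`
Hermitian, `gpar`/`Eterm` mapping Hermitian configurations of the ball to Hermitian values (on the `Ω_j` suffices for `Eterm`; everywhere for
`gpar`), the letter `R` mapping Hermitian-on-Ω data to Hermitian-on-Ω values and `G′` mapping Hermitian-on-Ω data to Hermitian configurations
(its range is supported on `Ω₀`); then the fixed point `s` has `λ_s(x)` Hermitian at every site. [cite: Balaban1985RegularSpaces, p.93 (after (1.102)), (1.100) p.93, (1.107) p.94] -/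
theorem propFive_fixedPoint_kLevel_selfAdjoint (hL : 1 ≤ L) (hη : 0 < η) (hU₀ : ∀ x κ, U₀ x κ ∈ unitaryUnits 𝔸)
    (Gp R gpar Eterm : (Site d → 𝔸) → (Site d → 𝔸))
    {α₄ BG BR a₁ b₁ cA cDA mE KE ℓ₀ ℓ₁ : ℝ}
    (hα₄ : 0 ≤ α₄) (hBG : 0 ≤ BG) (hBR : 0 ≤ BR) (ha₁ : 0 ≤ a₁) (ha₁' : a₁ ≤ 1 / 24) (hb₁ : 0 < b₁) (hb₁' : b₁ ≤ 1 / 140)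
    (hcA : 0 ≤ cA) (hcA' : cA ≤ 1 / 13) (hcDA : 0 ≤ cDA) (hmE : 0 ≤ mE) (hKE : 0 ≤ KE) (hℓ₀ : 0 ≤ ℓ₀) (hℓ₁ : 0 ≤ ℓ₁)
    (hθ : 10 * a₁ * BR ≤ 1 / 2)
    (hG : ∀ (f : Site d → 𝔸) (m : ℝ), 0 ≤ m → Bd2 L η k Ω f m →
      (∀ x, ‖Gp f x‖ ≤ BG * m) ∧ ∀ j, j ≤ k → ∀ p ∈ Eb j, wt L η j * ‖covDerivFwd η U₀ p.2 (Gp f) p.1‖ ≤ BG * m)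
    (hGsub : ∀ f g : Site d → 𝔸, Gp (f - g) = Gp f - Gp g)
    (hRsub : ∀ f g : Site d → 𝔸, R (f - g) = R f - R g)
    (hRbd : ∀ (f : Site d → 𝔸) (m : ℝ), 0 ≤ m → Bd2 L η k Ω f m → Bd2 L η k Ω (R f) (BR * m))
    (hg0 : ∀ s : lamSubK η U₀ L k Eb, ‖s‖ ≤ α₄ / 4 → ∀ j, j ≤ k → ∀ x ∈ Ω j, ‖gpar (lamOf s) x‖ ≤ a₁)
    (hg1 : ∀ s : lamSubK η U₀ L k Eb, ‖s‖ ≤ α₄ / 4 → ∀ j, j ≤ k → ∀ x ∈ Ω j, ∀ μ : Fin d,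
      wt L η j * ‖covDerivFwd η U₀ μ (gpar (lamOf s)) x‖ ≤ b₁ ∧ wt L η j * ‖covDeriv η U₀ μ (gpar (lamOf s)) x‖ ≤ b₁)
    (hgL : ∀ s t : lamSubK η U₀ L k Eb, ‖s‖ ≤ α₄ / 4 → ‖t‖ ≤ α₄ / 4 → ∀ j, j ≤ k → ∀ x ∈ Ω j,
      ‖gpar (lamOf s) x - gpar (lamOf t) x‖ ≤ ℓ₀ * ‖s - t‖ ∧ ∀ μ : Fin d,
        wt L η j * ‖covDerivFwd η U₀ μ (gpar (lamOf s) - gpar (lamOf t)) x‖ ≤ ℓ₁ * ‖s - t‖ ∧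
        wt L η j * ‖covDeriv η U₀ μ (gpar (lamOf s) - gpar (lamOf t)) x‖ ≤ ℓ₁ * ‖s - t‖)
    (hE0 : ∀ s : lamSubK η U₀ L k Eb, ‖s‖ ≤ α₄ / 4 → Bd2 L η k Ω (Eterm (lamOf s)) mE)
    (hEL : ∀ s t : lamSubK η U₀ L k Eb, ‖s‖ ≤ α₄ / 4 → ‖t‖ ≤ α₄ / 4 → Bd2 L η k Ω (Eterm (lamOf s) - Eterm (lamOf t)) (KE * ‖s - t‖))
    (hDA : Bd2 L η k Ω DA cDA)
    (hA : ∀ j, j ≤ k → ∀ x ∈ Ω j, ∀ μ : Fin d,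
      wt L η j * ‖A x μ‖ ≤ cA ∧ wt L η j * ‖conjR (U₀ (x - e μ) μ)⁻¹ (A (x - e μ) μ)‖ ≤ cA)
    (h103 : BG * Mc d BR b₁ cA mE cDA ≤ α₄ / 4) (h106 : BG * Kc d BR b₁ cA mE cDA KE ℓ₀ ℓ₁ ≤ 1 / 2)
    -- reality of the data
    (hAsa : ∀ x μ, IsSelfAdjoint (A x μ)) (hDAsa : ∀ j, j ≤ k → ∀ x ∈ Ω j, IsSelfAdjoint (DA x))
    (hgsa : ∀ s : lamSubK η U₀ L k Eb, ‖s‖ ≤ α₄ / 4 → (∀ x, IsSelfAdjoint (lamOf s x)) → ∀ x, IsSelfAdjoint (gpar (lamOf s) x))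
    (hEsa : ∀ s : lamSubK η U₀ L k Eb, ‖s‖ ≤ α₄ / 4 → (∀ x, IsSelfAdjoint (lamOf s x)) → ∀ j, j ≤ k → ∀ x ∈ Ω j,
      IsSelfAdjoint (Eterm (lamOf s) x))
    (hRreal : ∀ f : Site d → 𝔸, (∀ j, j ≤ k → ∀ x ∈ Ω j, IsSelfAdjoint (f x)) → ∀ j, j ≤ k → ∀ x ∈ Ω j, IsSelfAdjoint (R f x))
    (hGreal : ∀ f : Site d → 𝔸, (∀ j, j ≤ k → ∀ x ∈ Ω j, IsSelfAdjoint (f x)) → ∀ x, IsSelfAdjoint (Gp f x))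
    {s : lamSubK η U₀ L k Eb} (hs : ‖s‖ ≤ α₄ / 4) (hfix : lamOf s = Gp (PsiP5 η U₀ A DA R gpar Eterm (lamOf s))) :
    ∀ x, IsSelfAdjoint (lamOf s x) := by
  -- the invariance on the ball: every constituent preserves Hermitian data
  have hmW : 0 ≤ mWc d b₁ cA mE cDA := mWc_nonneg hb₁.le hcA hmE hcDA
  have hcV : 0 ≤ 10 * a₁ := by positivity
  have ha12 : a₁ ≤ 1 / 12 := by linarith
  have hb70 : b₁ ≤ 1 / 70 := by linarith
  have hcA12 : cA ≤ 1 / 12 := by linarith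
  have hreal : ∀ t : lamSubK η U₀ L k Eb, ‖t‖ ≤ α₄ / 4 → (∀ x, IsSelfAdjoint (lamOf t x)) →
      ∀ x, IsSelfAdjoint (Gp (PsiP5 η U₀ A DA R gpar Eterm (lamOf t)) x) := by
    intro t ht hsa
    have hasa : ∀ y, IsSelfAdjoint (gpar (lamOf t) y) := hgsa t ht hsa
    have hVsub : ∀ f g : Site d → 𝔸, ∀ j, j ≤ k → ∀ x ∈ Ω j,
        Vop (gpar (lamOf t)) f x - Vop (gpar (lamOf t)) g x = Vop (gpar (lamOf t)) (f - g) x :=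
      fun f g j hj x hx => Vop_sub f g ((hg0 t ht j hj x hx).trans ha12)
    have hVbd : ∀ f : Site d → 𝔸, ∀ j, j ≤ k → ∀ x ∈ Ω j, ‖Vop (gpar (lamOf t)) f x‖ ≤ 10 * a₁ * ‖f x‖ :=
      fun f j hj x hx => norm_Vop_le f (hg0 t ht j hj x hx) ha12
    have hW : Bd2 L η k Ω (Wsrc η U₀ A DA (gpar (lamOf t)) (Eterm (lamOf t))) (mWc d b₁ cA mE cDA) :=
      fun j hj x hx => wt_sq_norm_Wsrc_le hL hη hb70 hcA hcA12 ((hg0 t ht j hj x hx).trans ha12) (hg1 t ht j hj x hx) (hA j hj x hx)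
        (hE0 t ht j hj x hx) (hDA j hj x hx)
    have hWsa : ∀ j, j ≤ k → ∀ x ∈ Ω j, IsSelfAdjoint (Wsrc η U₀ A DA (gpar (lamOf t)) (Eterm (lamOf t)) x) :=
      fun j hj x hx => isSelfAdjoint_Wsrc hL hη hU₀ hb₁' hcA' hasa (hEsa t ht hsa j hj x hx) (hDAsa j hj x hx) hAsa
        ((hg0 t ht j hj x hx).trans ha₁') (hg1 t ht j hj x hx) (hA j hj x hx)
    have hVsa : ∀ f : Site d → 𝔸, ∀ j, j ≤ k → ∀ x ∈ Ω j, IsSelfAdjoint (f x) → IsSelfAdjoint (Vop (gpar (lamOf t)) f x) :=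
      fun f j hj x hx hf => isSelfAdjoint_Vop (hasa x) ((hg0 t ht j hj x hx).trans ha12) hf
    have hZsa : ∀ j, j ≤ k → ∀ x ∈ Ω j,
        IsSelfAdjoint (Zsol (Wsrc η U₀ A DA (gpar (lamOf t)) (Eterm (lamOf t))) (Vop (gpar (lamOf t))) R x) :=
      fun j hj x hx => isSelfAdjoint_zsol hL hη hVsub hVbd hRsub hRbd hW hcV hBR hmW hθ hWsa hVsa hRreal hj hx
    refine hGreal _ (hRreal _ fun j hj x hx => ?_)
    exact (hZsa j hj x hx).neg
  have hM0 : 0 ≤ Mc d BR b₁ cA mE cDA := by unfold Mc; positivity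
  have hKW : 0 ≤ KWc d b₁ cA mE cDA KE ℓ₀ ℓ₁ := B8Prop5ContractionKLevel.KWc_nonneg hb₁.le hcA hmE hcDA hKE hℓ₀ hℓ₁
  have hK0 : 0 ≤ Kc d BR b₁ cA mE cDA KE ℓ₀ ℓ₁ := by unfold Kc; positivity
  exact fixedPoint_kLevel_selfAdjoint_of_ball hη.le Ω Gp (PsiP5 η U₀ A DA R gpar Eterm) hα₄ hBG hM0 hK0
    (fun f m hm hf => hG f m hm hf) hGsub
    (fun t ht => psiP5_bd2 (Ω := Ω) (Eb := Eb) hL hη R gpar Eterm hBR ha₁ ha₁' hb₁ hb₁' hcA hcA' hcDA hmE hθ hRsub hRbd hg0 hg1 hE0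
      hDA hA t ht)
    (fun t₁ t₂ ht₁ ht₂ j hj x hx => by
      simpa only [Pi.sub_apply] using psiP5_sub_bd2 (Ω := Ω) (Eb := Eb) hL hη R gpar Eterm hBR ha₁ ha₁' hb₁ hb₁' hcA hcA' hcDA hmE hKE
        hℓ₀ hℓ₁ hθ hRsub hRbd hg0 hg1 hgL hE0 hEL hDA hA t₁ t₂ ht₁ ht₂ j hj x hx)
    h103 h106 hreal hs hfix

end FixedPoint

#print axioms isSelfAdjoint_gAd
#print axioms isSelfAdjoint_frakF3
#print axioms propFive_fixedPoint_kLevel_selfAdjoint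

end Literature.MathematicalPhysics.QuantumFieldTheory.Balaban1983to89.B8Prop5Reality

end
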